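import Summits.RiemannHypothesis.RiemannHypothesis.Theorems.WeilSemilocalWallsTenKGapSplit
import Summits.RiemannHypothesis.RiemannHypothesis.Theorems.WeilSemilocalWallsTenKTwin
import Summits.RiemannHypothesis.RiemannHypothesis.Theorems.WeilSemilocalWallsTenKNonTwin
import HarnessLib

/-!
# Route `WeilSemilocal` — CLOSER of the crux `SemilocalWallsToTenThousand` (item stmt-RiemannHypothesis-19395; RH-FREE)

C-I(a) at EVERY prime `157 ≤ q < 10⁴`: for every prime `q' > q`, `a*(S_q) = weilSemilocalThreshold (Nat.primesBelow q) < (log q')/2`.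
The layer-2 split by gap class recombined: `wallsTenKGapSplit_proof` (glue, p-19174) applied to `wallsTenKTwin_proof` (twins, tier-2 theta
certificate, p468941) and `wallsTenKNonTwin_proof` (gap `≥ 4`, tier-1 theta certificate, p441504).  UPPER clauses of truncated Weil forms only
(LADDER-RH W-P(P2), cell `rh-explicit`, typing lane cc-s2-1 gen23); nothing here bears on the truth of RH.
-/

set_option linter.dupNamespace false  -- the mandated namespace repeats `RiemannHypothesis`
set_option autoImplicit false

namespace Summit.RiemannHypothesis.RiemannHypothesis.Theorems.WeilSemilocalRoute

/-- **CLOSER of the crux `SemilocalWallsToTenThousand`** (item stmt-RiemannHypothesis-19395, `route-RiemannHypothesis-WeilSemilocal`):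
C-I(a) at every prime `157 ≤ q < 10⁴`. [this cell; gap-class glue ∘ (tier-2 twins, tier-1 non-twins)] -/
theorem semilocalWallsToTenThousand_proof :
    Summit.RiemannHypothesis.RiemannHypothesis.Theses.WeilSemilocal.SemilocalWallsToTenThousand :=
  wallsTenKGapSplit_proof wallsTenKTwin_proof wallsTenKNonTwin_proof

end Summit.RiemannHypothesis.RiemannHypothesis.Theorems.WeilSemilocalRoute
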